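import Summits.RiemannHypothesis.RiemannHypothesis.Theorems.PfPersistenceConeSigns
import Summits.RiemannHypothesis.RiemannHypothesis.Theorems.PfPersistenceF2PlantedIndex
import HarnessLib

/-!
# PF persistence — RANK-ONE DOMINANCE (Perron–Frobenius by dominance)
(pub-rhpf, barrier-prover gen 3, LEAD g10 assignment on a suggestion of cand-7 g6; file 3 of 3)

**HONEST FRAMING. This is a long-odds MECHANISM SEARCH; no RH claims.** RH-free finite-dimensional linear
algebra; every statement PROVED; no DATA; no sentence about `ζ`.

**THE LEMMA.** Let `T` be a real symmetric `(n+1) × (n+1)` matrix with form bound `|vᵀTv| ≤ B|v|²` (e.g.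
`B := Σ|T_ij|`, `abs_form_le_entrySum_mul`), `u` a vector with coordinates `≥ m > 0`, and `c` a coupling with
`2B(|u|² + m²) < c |u|² m²` — division-free; with `B := Σ|T_ij|` and `m := minᵢ uᵢ` it reads `c > c₀(T, u)`,
`dominanceThreshold T u := 2(Σ|T_ij|)(|u|² + m²)/(|u|² m²)`. Then `M_c := T − c·u uᵀ` has
(i) `ε₁(M_c) < 0`; (ii) a bottom vector; (iii) EVERY bottom vector strictly one-signed coordinatewise; hence
(iv) a SIMPLE bottom (`rankOneDominance`, `rankOneDominance_explicit`, `bottom_simple_of_oneSign`).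
Proof: variational Davis–Kahan (`PfPersistenceBottomVectors`) against the reference `−c·u uᵀ` (bottom `−c|u|²`
at `u`, variational gap `c|u|²`; the perturbation is `−T`, of form size `B`) puts every bottom vector in the
`2B/(c|u|²)`-cone of `u`, which `PfPersistenceConeSigns` converts to signs.

**PROFILE FLAVOUR** (`rankOneDominance_profile`, the cell's `theta` tier): if instead the reference `u` has a
ONE-SIGNED PROFILE WITH MARGIN `m₀ > 0` on the window of length `L > 0` (its Galerkin coordinates may alternate in
sign, as those of a positive function typically do) and `2B((2N+1)|u|² + m₀² L) < c (|u|² m₀² L)`, every bottom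
vector of `T − c·u uᵀ` has a ONE-SIGNED PROFILE, `ε₁ < 0`, and a bottom vector exists. (Context pointer only —
nothing about `ζ` is asserted or used in this file: the rank-one structure of the even window form of the
ExplicitDatum cell's pole-pair family is the tree theorem `polePairDatum_re_quadratic_of_isEven`, commit
4fb4ea7e96ec, cand-7.)
-/

set_option linter.dupNamespace false  -- the mandated namespace repeats `RiemannHypothesis`

noncomputable section

open Real Finset Matrix Set

namespace Summit.RiemannHypothesis.RiemannHypothesis.Theorems.PfPersistence

/-! ## §6 RANK-ONE DOMINANCE (Perron–Frobenius by dominance) -/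

/-- PROVED: the quadratic form of the rank-one lowering, `vᵀ(T − c·u uᵀ)v = vᵀTv − c (u·v)²`. [folklore] -/
theorem form_sub_rankOne {n : ℕ} (T : Matrix (Fin n) (Fin n) ℝ) (c : ℝ) (u v : Fin n → ℝ) :
    v ⬝ᵥ ((T - c • vecMulVec u u) *ᵥ v) = v ⬝ᵥ (T *ᵥ v) - c * (u ⬝ᵥ v) ^ 2 := by
  rw [sub_mulVec, Matrix.smul_mulVec, PfPersistenceF2PlantedIndex.vecMulVec_mulVec_eq, dotProduct_sub,
    dotProduct_smul, dotProduct_smul,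
    smul_eq_mul, smul_eq_mul, dotProduct_comm v u, sq]

/-- PROVED: the quadratic form of `−c·u uᵀ` is `−c (u·v)²`. [folklore] -/
theorem form_neg_rankOne {n : ℕ} (c : ℝ) (u v : Fin n → ℝ) :
    v ⬝ᵥ ((-(c • vecMulVec u u)) *ᵥ v) = -(c * (u ⬝ᵥ v) ^ 2) := by
  rw [neg_mulVec, dotProduct_neg, Matrix.smul_mulVec, PfPersistenceF2PlantedIndex.vecMulVec_mulVec_eq,
    dotProduct_smul, dotProduct_smul,
    smul_eq_mul, smul_eq_mul, dotProduct_comm v u, sq]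

/-- PROVED: `u uᵀ` is symmetric, hence so is `T − c·u uᵀ` for symmetric `T`. [folklore] -/
theorem isSymm_sub_rankOne {n : ℕ} {T : Matrix (Fin n) (Fin n) ℝ} (hT : T.IsSymm) (c : ℝ) (u : Fin n → ℝ) :
    (T - c • vecMulVec u u).IsSymm :=
  hT.sub ((Matrix.IsSymm.ext fun i j => by simp [vecMulVec_apply, mul_comm]).smul c)

/-- PROVED: the reference matrix `−c·u uᵀ` (`c ≥ 0`, `u ≠ 0`) has `ε₁ = −c|u|²`, bottom vector `u`, and the
variational gap `c|u|²` (the form vanishes on `u^⊥`): `HasBottomGap (−c·u uᵀ) u (c|u|²)` for `c > 0`. [folklore] -/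
theorem hasBottomGap_neg_rankOne {n : ℕ} {c : ℝ} (hc : 0 < c) {u : Fin (n + 1) → ℝ} (hu : u ≠ 0) :
    HasBottomGap (-(c • vecMulVec u u)) u (c * (u ⬝ᵥ u)) := by
  have hs : 0 < u ⬝ᵥ u := dotSelf_pos_of_ne_zero hu
  have hbot : bottomRayleigh (-(c • vecMulVec u u)) = -(c * (u ⬝ᵥ u)) := by
    refine le_antisymm ?_ (le_bottomRayleigh_of_forall _ fun v hv => ?_)
    · have h := bottomRayleigh_le_rayleigh (-(c • vecMulVec u u)) hu
      rw [form_neg_rankOne, sq, ← mul_assoc, neg_div, mul_div_assoc, div_self hs.ne', mul_one] at h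
      exact h
    · have hvv : 0 < v ⬝ᵥ v := dotSelf_pos_of_ne_zero hv
      rw [form_neg_rankOne, le_div_iff₀ hvv]
      have hcs : (u ⬝ᵥ v) ^ 2 ≤ (u ⬝ᵥ u) * (v ⬝ᵥ v) := by
        simpa only [dotProduct, sq] using Finset.sum_mul_sq_le_sq_mul_sq Finset.univ u v
      nlinarith [mul_le_mul_of_nonneg_left hcs hc.le]
  refine ⟨⟨hu, ?_⟩, mul_pos hc hs, fun v hv => ?_⟩
  · rw [hbot, neg_mulVec, Matrix.smul_mulVec, PfPersistenceF2PlantedIndex.vecMulVec_mulVec_eq, smul_smul, neg_smul]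
  · rw [hbot, form_neg_rankOne, dotProduct_comm u v, hv]
    simp

/-- **PROVED — RANK-ONE DOMINANCE (Perron–Frobenius by dominance).** Let `T` be a real symmetric
`(n+1) × (n+1)` matrix with form bound `|vᵀTv| ≤ B|v|²`, `u` a vector with coordinates `≥ m > 0`, and `c` a
coupling with `2B(|u|² + m²) < c (|u|² m²)`. Then `M_c := T − c·u uᵀ` has: (i) `ε₁(M_c) < 0`; (ii) a bottom
vector; (iii) EVERY bottom vector strictly one-signed coordinatewise. Proof: Davis–Kahan (§4) against the
reference `−c·u uᵀ` (gap `c|u|²`, perturbation `−T` of size `B`) puts every bottom vector in the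
`2B/(c|u|²)`-cone of `u`, which §5 converts to signs. [folklore] -/
theorem rankOneDominance {n : ℕ} {T : Matrix (Fin (n + 1)) (Fin (n + 1)) ℝ} (hT : T.IsSymm) {B : ℝ}
    (hB : ∀ v : Fin (n + 1) → ℝ, |v ⬝ᵥ (T *ᵥ v)| ≤ B * (v ⬝ᵥ v)) {u : Fin (n + 1) → ℝ} {m : ℝ}
    (hm : 0 < m) (hmu : ∀ i, m ≤ u i) {c : ℝ} (hc : 2 * B * (u ⬝ᵥ u + m ^ 2) < c * ((u ⬝ᵥ u) * m ^ 2)) :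
    bottomRayleigh (T - c • vecMulVec u u) < 0 ∧
      (∃ x, IsBottomVector (T - c • vecMulVec u u) x) ∧
      ∀ x, IsBottomVector (T - c • vecMulVec u u) x → (∀ i, 0 < x i) ∨ (∀ i, x i < 0) := by
  have hupos : ∀ i, 0 < u i := fun i => lt_of_lt_of_le hm (hmu i)
  have hu : u ≠ 0 := fun h => (hupos 0).ne' (by simp [h])
  have hs : 0 < u ⬝ᵥ u := dotSelf_pos_of_ne_zero hu
  have hB0 : 0 ≤ B := by
    have h := (abs_nonneg _).trans (hB u)
    exact nonneg_of_mul_nonneg_left (by linarith) hs  -- 0 ≤ B * s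
  have hm2 : 0 < m ^ 2 := pow_pos hm 2
  have hsm : 0 < (u ⬝ᵥ u) * m ^ 2 := mul_pos hs hm2
  have hc0 : 0 < c := by
    have : 0 < c * ((u ⬝ᵥ u) * m ^ 2) := lt_of_le_of_lt (by positivity) hc
    exact pos_of_mul_pos_left this hsm.le
  -- 2B < c|u|²  (hence B < c|u|²)
  have hcs : 2 * B < c * (u ⬝ᵥ u) := by
    by_contra hle
    push Not at hle
    have := mul_le_mul_of_nonneg_right hle hm2.le
    nlinarith [mul_nonneg hB0 hs.le]
  refine ⟨?_, ?_, ?_⟩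
  · -- (i) test vector `u`: uᵀM_c u = uᵀTu − c|u|⁴ ≤ (B − c|u|²)|u|² < 0
    have h := bottomRayleigh_le_rayleigh (T - c • vecMulVec u u) hu
    rw [form_sub_rankOne] at h
    have hTu := (abs_le.1 (hB u)).2
    have hneg : u ⬝ᵥ (T *ᵥ u) - c * (u ⬝ᵥ u) ^ 2 < 0 := by nlinarith
    exact lt_of_le_of_lt h (div_neg_of_neg_of_pos hneg hs)
  · -- (ii) existence: `M_c` is symmetric
    obtain ⟨x, hx, -⟩ := exists_isBottomVector_of_isSymm (isSymm_sub_rankOne hT c u)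
    exact ⟨x, hx⟩
  · -- (iii) Davis–Kahan against `−c·u uᵀ`, then cone ⇒ signs
    intro x hx
    have hgap := hasBottomGap_neg_rankOne hc0 hu (n := n)
    have hclose : ∀ v : Fin (n + 1) → ℝ,
        |v ⬝ᵥ ((-(c • vecMulVec u u) - (T - c • vecMulVec u u)) *ᵥ v)| ≤ B * (v ⬝ᵥ v) := by
      intro v
      have e : -(c • vecMulVec u u) - (T - c • vecMulVec u u) = -T := by abel
      rw [e, neg_mulVec, dotProduct_neg, abs_neg]
      exact hB v
    have hsymm0 : (-(c • vecMulVec u u)).IsSymm :=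
      ((Matrix.IsSymm.ext fun i j => by simp [vecMulVec_apply, mul_comm]).smul c).neg
    have hcone : SinSqLe (2 * B / (c * (u ⬝ᵥ u))) x u := sinSqLe_of_isBottomVector hsymm0 hgap hclose hx
    refine oneSign_coords_of_sinSqLe hcone hx.1 hupos fun i => ?_
    -- τ|u|² = 2B/c and (1 − τ) (u i)² ≥ (1 − τ) m² > τ |u|²
    have hcs' : 0 < c * (u ⬝ᵥ u) := mul_pos hc0 hs
    have hτ1 : 2 * B / (c * (u ⬝ᵥ u)) ≤ 1 := by
      rw [div_le_one hcs']
      linarith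
    have hui : m ^ 2 ≤ u i ^ 2 := pow_le_pow_left₀ hm.le (hmu i) 2
    have step : 2 * B / (c * (u ⬝ᵥ u)) * (u ⬝ᵥ u) < (1 - 2 * B / (c * (u ⬝ᵥ u))) * m ^ 2 := by
      -- multiply the defining inequality `hc` by 1/(c|u|²) > 0
      rw [sub_mul, one_mul, lt_sub_iff_add_lt, ← mul_add, div_mul_eq_mul_div, div_lt_iff₀ hcs']
      nlinarith [hc]
    calc 2 * B / (c * (u ⬝ᵥ u)) * (u ⬝ᵥ u)
        < (1 - 2 * B / (c * (u ⬝ᵥ u))) * m ^ 2 := step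
      _ ≤ (1 - 2 * B / (c * (u ⬝ᵥ u))) * u i ^ 2 :=
          mul_le_mul_of_nonneg_left hui (sub_nonneg.2 hτ1)

/-- **PROVED — STRICTLY ONE-SIGNED BOTTOMS ARE SIMPLE.** If every bottom vector of `M` is strictly one-signed
coordinatewise, any two bottom vectors are parallel (a combination with a vanishing coordinate would again be a
bottom vector). [folklore] -/
theorem bottom_simple_of_oneSign {n : ℕ} {M : Matrix (Fin (n + 1)) (Fin (n + 1)) ℝ}
    (h : ∀ x, IsBottomVector M x → (∀ i, 0 < x i) ∨ (∀ i, x i < 0)) {x y : Fin (n + 1) → ℝ}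
    (hx : IsBottomVector M x) (hy : IsBottomVector M y) : ∃ t : ℝ, y = t • x := by
  have hx0 : x 0 ≠ 0 := by
    rcases h x hx with h' | h'
    · exact (h' 0).ne'
    · exact (h' 0).ne
  refine ⟨y 0 / x 0, ?_⟩
  by_contra hne
  set z : Fin (n + 1) → ℝ := y - (y 0 / x 0) • x with hz
  have hz0 : z ≠ 0 := fun h0 => hne (sub_eq_zero.1 h0)
  have hzb : IsBottomVector M z := by
    refine ⟨hz0, ?_⟩
    show M *ᵥ (y - (y 0 / x 0) • x) = bottomRayleigh M • (y - (y 0 / x 0) • x)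
    rw [mulVec_sub, mulVec_smul, hx.2, hy.2, smul_sub, smul_comm]
  have hz00 : z 0 = 0 := by
    simp [hz, div_mul_cancel₀ _ hx0]
  rcases h z hzb with h' | h'
  · exact (h' 0).ne' hz00
  · exact (h' 0).ne hz00

/-- the least coordinate of a vector in positive dimension. -/
def minCoord {n : ℕ} (u : Fin (n + 1) → ℝ) : ℝ := Finset.univ.inf' Finset.univ_nonempty u

/-- PROVED: `minCoord u ≤ u i`. [folklore] -/
theorem minCoord_le {n : ℕ} (u : Fin (n + 1) → ℝ) (i : Fin (n + 1)) : minCoord u ≤ u i :=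
  Finset.inf'_le _ (Finset.mem_univ i)

/-- PROVED: a coordinatewise-positive vector has positive least coordinate. [folklore] -/
theorem minCoord_pos {n : ℕ} {u : Fin (n + 1) → ℝ} (hu : ∀ i, 0 < u i) : 0 < minCoord u := by
  obtain ⟨i, -, hi⟩ := Finset.exists_mem_eq_inf' Finset.univ_nonempty u
  rw [minCoord, hi]
  exact hu i

/-- **THE EXPLICIT DOMINANCE THRESHOLD** `c₀(T, u) := 2 (Σ|T_ij|) (|u|² + m²) / (|u|² m²)`, `m := minᵢ uᵢ`.
 -/
def dominanceThreshold {n : ℕ} (T : Matrix (Fin (n + 1)) (Fin (n + 1)) ℝ) (u : Fin (n + 1) → ℝ) : ℝ :=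
  2 * entrySum T * (u ⬝ᵥ u + minCoord u ^ 2) / ((u ⬝ᵥ u) * minCoord u ^ 2)

/-- **PROVED — RANK-ONE DOMINANCE, explicit threshold.** For `T` real symmetric, `u` coordinatewise positive and
`c > c₀(T, u)` (`dominanceThreshold`, built from `Σ|T_ij|` and `minᵢ uᵢ / |u|`): `T − c·u uᵀ` has negative bottom,
a bottom vector, every bottom vector strictly one-signed, and a simple bottom. [folklore] -/
theorem rankOneDominance_explicit {n : ℕ} {T : Matrix (Fin (n + 1)) (Fin (n + 1)) ℝ} (hT : T.IsSymm)
    {u : Fin (n + 1) → ℝ} (hu : ∀ i, 0 < u i) {c : ℝ} (hc : dominanceThreshold T u < c) :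
    bottomRayleigh (T - c • vecMulVec u u) < 0 ∧
      (∃ x, IsBottomVector (T - c • vecMulVec u u) x) ∧
      (∀ x, IsBottomVector (T - c • vecMulVec u u) x → (∀ i, 0 < x i) ∨ (∀ i, x i < 0)) ∧
      ∀ x y, IsBottomVector (T - c • vecMulVec u u) x → IsBottomVector (T - c • vecMulVec u u) y →
        ∃ t : ℝ, y = t • x := by
  have hm := minCoord_pos hu
  have hu0 : u ≠ 0 := fun h => (hu 0).ne' (by simp [h])
  have hs : 0 < u ⬝ᵥ u := dotSelf_pos_of_ne_zero hu0
  have hc' : 2 * entrySum T * (u ⬝ᵥ u + minCoord u ^ 2) < c * ((u ⬝ᵥ u) * minCoord u ^ 2) := by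
    have hD : 0 < (u ⬝ᵥ u) * minCoord u ^ 2 := mul_pos hs (pow_pos hm 2)
    exact (div_lt_iff₀ hD).1 hc
  obtain ⟨h1, h2, h3⟩ := rankOneDominance hT (abs_form_le_entrySum_mul T) hm (minCoord_le u) hc'
  exact ⟨h1, h2, h3, fun x y hx hy => bottom_simple_of_oneSign h3 hx hy⟩

/-- **PROVED — RANK-ONE DOMINANCE, profile flavour (the cell's `theta` tier).** Same setting, but the reference
vector `u` is only assumed to have a ONE-SIGNED PROFILE WITH MARGIN `m₀ > 0` on the window of length `L > 0`
(its coordinates may alternate in sign, as Galerkin coefficients of a positive function typically do); if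
`2B((2N+1)|u|² + m₀² L) < c (|u|² m₀² L)` then every bottom vector of `T − c·u uᵀ` has a ONE-SIGNED PROFILE,
and `ε₁ < 0`, and a bottom vector exists. [folklore] -/
theorem rankOneDominance_profile {N : ℕ} {T : Matrix (Fin (N + 1)) (Fin (N + 1)) ℝ} (hT : T.IsSymm) {B : ℝ}
    (hB : ∀ v : Fin (N + 1) → ℝ, |v ⬝ᵥ (T *ᵥ v)| ≤ B * (v ⬝ᵥ v)) {L m₀ : ℝ} (hL : 0 < L) (hm₀ : 0 < m₀)
    {u : Fin (N + 1) → ℝ} (hmar : OneSignedMargin L m₀ u) {c : ℝ}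
    (hc : 2 * B * ((2 * N + 1) * (u ⬝ᵥ u) + m₀ ^ 2 * L) < c * ((u ⬝ᵥ u) * (m₀ ^ 2 * L))) :
    bottomRayleigh (T - c • vecMulVec u u) < 0 ∧
      (∃ x, IsBottomVector (T - c • vecMulVec u u) x) ∧
      ∀ x, IsBottomVector (T - c • vecMulVec u u) x → OneSigned L x := by
  -- `u ≠ 0`: a zero vector has the zero profile, which has no positive margin at `x = 0`
  have hu : u ≠ 0 := by
    intro h0
    have hx0 : (0 : ℝ) ∈ Icc (-(L / 2)) (L / 2) := ⟨by linarith, by linarith⟩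
    have hz : profile L u 0 = 0 := by simp [profile, h0]
    rcases hmar with hm | hm
    · have := hm 0 hx0; rw [hz] at this; linarith
    · have := hm 0 hx0; rw [hz] at this; linarith
  have hs : 0 < u ⬝ᵥ u := dotSelf_pos_of_ne_zero hu
  have hB0 : 0 ≤ B := by
    have h := (abs_nonneg _).trans (hB u)
    exact nonneg_of_mul_nonneg_left (by linarith) hs
  have hmL : 0 < m₀ ^ 2 * L := mul_pos (pow_pos hm₀ 2) hL
  have hD : 0 < (u ⬝ᵥ u) * (m₀ ^ 2 * L) := mul_pos hs hmL
  have hc0 : 0 < c := by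
    have : 0 < c * ((u ⬝ᵥ u) * (m₀ ^ 2 * L)) := lt_of_le_of_lt (by positivity) hc
    exact pos_of_mul_pos_left this hD.le
  have hcs : 2 * B < c * (u ⬝ᵥ u) := by
    by_contra hle
    push Not at hle
    have := mul_le_mul_of_nonneg_right hle hmL.le
    have hN : (0 : ℝ) ≤ 2 * N + 1 := by positivity
    nlinarith [mul_nonneg hB0 (mul_nonneg hN hs.le)]
  refine ⟨?_, ?_, ?_⟩
  · have h := bottomRayleigh_le_rayleigh (T - c • vecMulVec u u) hu
    rw [form_sub_rankOne] at h
    have hTu := (abs_le.1 (hB u)).2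
    have hneg : u ⬝ᵥ (T *ᵥ u) - c * (u ⬝ᵥ u) ^ 2 < 0 := by nlinarith
    exact lt_of_le_of_lt h (div_neg_of_neg_of_pos hneg hs)
  · obtain ⟨x, hx, -⟩ := exists_isBottomVector_of_isSymm (isSymm_sub_rankOne hT c u)
    exact ⟨x, hx⟩
  · intro x hx
    have hgap := hasBottomGap_neg_rankOne hc0 hu (n := N)
    have hclose : ∀ v : Fin (N + 1) → ℝ,
        |v ⬝ᵥ ((-(c • vecMulVec u u) - (T - c • vecMulVec u u)) *ᵥ v)| ≤ B * (v ⬝ᵥ v) := by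
      intro v
      have e : -(c • vecMulVec u u) - (T - c • vecMulVec u u) = -T := by abel
      rw [e, neg_mulVec, dotProduct_neg, abs_neg]
      exact hB v
    have hsymm0 : (-(c • vecMulVec u u)).IsSymm :=
      ((Matrix.IsSymm.ext fun i j => by simp [vecMulVec_apply, mul_comm]).smul c).neg
    have hcone : SinSqLe (2 * B / (c * (u ⬝ᵥ u))) x u := sinSqLe_of_isBottomVector hsymm0 hgap hclose hx
    refine oneSigned_of_sinSqLe hL hmar hm₀ hcone hx.1 ?_
    have hcs' : 0 < c * (u ⬝ᵥ u) := mul_pos hc0 hs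
    -- τ|u|²(2N+1) = 2B(2N+1)/c < (1 − τ) m₀² L  ⇔  2B((2N+1)|u|² + m₀²L) < c|u|² m₀² L
    rw [sub_mul, sub_mul, one_mul, lt_sub_iff_add_lt, div_mul_eq_mul_div, div_mul_eq_mul_div,
      div_mul_eq_mul_div, div_mul_eq_mul_div, ← add_div, div_lt_iff₀ hcs']
    nlinarith [hc]

end Summit.RiemannHypothesis.RiemannHypothesis.Theorems.PfPersistence

end
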